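import Literature.MathematicalPhysics.QuantumFieldTheory.Balaban1983to89.Beta.SecondOrderResponse
import Literature.MathematicalPhysics.QuantumFieldTheory.Balaban1983to89.Beta.HessKerRate

/-!
# `BalabanUV.Beta.GAN24.SecondOrderLipschitz` — THE SECOND-ORDER RESPONSE CARRIER IS LIPSCHITZ IN ITS ARGUMENTS, part 1:
# telescoping bricks, the multiplier-column vertex, `dM`, the three-kernel sandwich and THE DERIVATIVE OF THE INVERSE `K2OfK`
# (G-an2-4 formalisation swarm, leaf prover 03, gen 16; generic engine toward the W-slot's CAUCHY binder `hWall` ∕ `hW₂all`)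

NOT IN PRINT; OUR PROOF (elementary).  HONEST FRAMING (cell contract, verbatim): «discharging `BetaPertH` makes Bałaban's UV stability
UNCONDITIONAL — a real constructive-QFT result; it is NOT the continuum limit and NOT the Clay problem.»  HONEST DEPENDENCY (verbatim):
«continuum YM on T⁴ ⇐ BetaPertH ∧ nine spine estimates (0/9 proved); BetaPertH ⇐ (D1) ∧ (D4) ∧ CAP+tail; G-an2-4 gates asym, D1 and
NE2/3/4.»

WHAT.  an2's `Beta/SecondOrderResponse` builds the second-order background family `W2OfK K N S M S₂ M₂` (and its swap-symmetrisation
`W2SymOfK`) of a bordered operator through an ARBITRARY packed resolvent `K`, and proves its localisation `vertexFamily₂_W2SymOfK` from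
decay of `K` and localisation of the four tables.  The wall's W-slot at `d = 3` (`StencilSlotWallThree.d1Drift_JsBalOf_iff_three_of_diffRows`,
binders `hW₂`, `hW₂all`) asks, for an2's family `W j := WbalOf … j` in dressed units (`SecondOrderUnits.unitW_WbalOf`:
`unitW_j (WbalOf … j) = W2SymOfK (unitK_j K_j) Lc (unitS_j S_j) (unitM_j M_j) (unitS₂_j S₂_j) (unitM₂_j M₂_j)`), a `j`-UNIFORM localisation (`hW₂`)
AND a CAUCHY estimate `VertexFamily₂ (W_{k+j} − W_k) Lc (cW θ^k) δW` (`hW₂all`).  The uniform half is an2's theorem applied member by member;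
the Cauchy half needs the carrier to be LIPSCHITZ in `(K, S, M, S₂, M₂)` — the order-two twin of asym1's `HessKerRate.vertexFamily_vertexOfK_sub`.
This module is part 1 of that twin: the first-order carriers.

HOW ([folklore]; every analytic brick BY NAME, none re-proved).  Differences are telescoped AT THE BRICK LEVEL —
`wsum w T − wsum w′ T′ = wsum (w − w′) T + wsum w′ (T − T′)` (§1 `wsum_sub_wsum_bdd`, under summability: weights exponentially decaying,
kernels uniformly bounded; its coarse twin `cwsum_sub_cwsum_bdd` through `InterLevelTransport.onLat`) and `KernelWard.comp_sub_left∕right` for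
compositions — and each telescoped term is bounded by an2's ORIGINAL localisation brick (`InterLevelTransport.biLoc_cwsum`,
`ExpKernelCalculus.biLoc_comp_decays`, `BalabanStepJetsSucc.biLoc_comp_right`, asym1's `HessKerRate.biLoc_comp_sub_comp` ∕
`vertexFamily_vertexOfK_sub`).  Constants are EXPLICIT (`ldM`, `lSand`, `lK2`) and LINEAR in the deviations `(εK, εS, εM)`.
* §1 bricks: `summable_wsum_bdd`, `wsum_sub_wsum_bdd`, `onLat_sub`, `cwsum_sub_cwsum_bdd`, `mul_exp_neg_le`.
* §2 `colM_sub`, **`vertexFamily_vertexOfM_sub`** (constant `(d+1)·((εK·CM + C·εM)·Zl(δ/2))`, rate `δ/2`), **`vertexFamily_dM_sub`** (constant `ldM`).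
* §3 **`biLoc_sandwich_sub`**: `K∘V∘K − K′∘V′∘K′` for decaying `K, K′` (deviation `εK`) and bi-localised `V, V′` (deviation `εV`): bi-localised with
  constant `lSand`, rate `m/4`; **`vertexFamily_K2OfK_sub`**: `VertexFamily (K2OfK K N S M − K2OfK K′ N S′ M′) N (lK2 …) (m/8)`.
Part 2 (`SecondOrderLipschitzBi`): the bi-vertex, mixed and second-response pieces; part 3 (`SecondOrderLipschitzW2`): `W2OfK`, `W2SymOfK`,
the family (Cauchy) form.

HONEST: generic kernel algebra over an2's carriers; instantiates NO binder of the wall, asserts NO shape of Bałaban's tables («T2Shape» ∕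
«T2Drift» stay located ∕ OPEN), discharges NOTHING of (hW, hWall); NOT «W-slot closed», NEVER «G-an2-4 closed»; NOT BetaPertH, NOT continuum,
NOT Clay.  0 sorry, 0 cite, 0 `def … : Prop`.
-/

noncomputable section

open Finset
open scoped BigOperators
open Literature.MathematicalPhysics.QuantumFieldTheory
open Literature.MathematicalPhysics.QuantumFieldTheory.Balaban1983to89
open Literature.MathematicalPhysics.QuantumFieldTheory.Balaban1983to89.Beta
open Literature.Probability.LatticeModels (Torus.proj)
open LatticeForm (quo)
open B12Sec2to5 (l1 l1_nonneg)
open ExpKernelCalculus (MKer Decays BiLoc VertexFamily comp Zl Zl_nonneg summable_exp_shift' biLoc_comp_decays)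
open OneStepResolventKernel (Fib LocStencil wsum eq_zsmul_quo_of_proj bound_mono decays_mono biLoc_mono)
open OneStepKernelFamily (vertexOfK)
open InterLevelTransport (onLat onLat_off cwsum biLoc_cwsum)
open KernelWard (Bdd bdd_of_decays bdd_of_biLoc biLoc_add slices_biLoc_bdd comp_sub_left comp_sub_right)
open HessKerRate (biLoc_comp_sub_comp vertexFamily_vertexOfK_sub)
open BalabanStepJetsSucc (biLoc_comp_right)
open SecondOrderResponse (colM abs_colM_le vertexOfM dM K2OfK vertexFamily_dM biLoc_neg cdM cdM_nonneg)

namespace Summit.QuantumFields.BalabanUV.Beta.GAN24.SecondOrderLipschitz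

variable {d : ℕ}

/-! ## §1 Telescoping bricks under summability -/

section Bricks

variable {D : ℕ} {F : Type*}

/-- [folklore] Exponentially decaying weights against uniformly bounded kernel entries give an absolutely convergent superposition. -/
theorem summable_wsum_bdd {w : (Fin D → ℤ) → ℝ} {K : (Fin D → ℤ) → MKer D F} {C m B : ℝ} {p : Fin D → ℤ}
    (hw : ∀ u, |w u| ≤ C * Real.exp (-m * l1 (u - p))) (hm : 0 < m) (x z : Fin D → ℤ) (a b : F)
    (hK : ∀ u, |K u x z a b| ≤ B) : Summable fun u : Fin D → ℤ => w u * K u x z a b := by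
  refine Summable.of_norm_bounded ((summable_exp_shift' hm p).mul_left (C * B)) (fun u => ?_)
  rw [Real.norm_eq_abs, abs_mul]
  have h1 := hw u
  have h2 := hK u
  calc |w u| * |K u x z a b| ≤ (C * Real.exp (-m * l1 (u - p))) * B :=
        mul_le_mul h1 h2 (abs_nonneg _) ((abs_nonneg _).trans h1)
    _ = C * B * Real.exp (-m * l1 (u - p)) := by ring

/-- [folklore] **TELESCOPING OF WEIGHTED SUPERPOSITIONS** (bounded-kernel form): `wsum w K − wsum w′ K′ = wsum (w − w′) K + wsum w′ (K − K′)`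
whenever the weights decay exponentially from a point and the kernel entries are uniformly bounded in the summation index (so that the
three series involved converge absolutely).  The twin of asym1's `HessKerRate.wsum_sub_wsum` with the self-localisation hypothesis replaced by a
bound — which is what the far-centred families of the second-order carriers offer. -/
theorem wsum_sub_wsum_bdd {w w' : (Fin D → ℤ) → ℝ} {K K' : (Fin D → ℤ) → MKer D F} {C C' m B B' : ℝ} {p : Fin D → ℤ}
    (hw : ∀ u, |w u| ≤ C * Real.exp (-m * l1 (u - p))) (hw' : ∀ u, |w' u| ≤ C' * Real.exp (-m * l1 (u - p))) (hm : 0 < m)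
    (hK : ∀ u x z a b, |K u x z a b| ≤ B) (hK' : ∀ u x z a b, |K' u x z a b| ≤ B') :
    wsum w K - wsum w' K' = wsum (w - w') K + wsum w' (K - K') := by
  funext x z a b
  have hs := summable_wsum_bdd hw hm x z a b (fun u => hK u x z a b)
  have hs' := summable_wsum_bdd hw' hm x z a b (fun u => hK' u x z a b)
  have hsK := summable_wsum_bdd hw' hm x z a b (fun u => hK u x z a b)
  simp only [Pi.sub_apply, Pi.add_apply, wsum]
  have h1 : (fun u => (w u - w' u) * K u x z a b) = fun u => w u * K u x z a b - w' u * K u x z a b :=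
    funext fun u => by ring
  have h2 : (fun u => w' u * (K u x z a b - K' u x z a b)) = fun u => w' u * K u x z a b - w' u * K' u x z a b :=
    funext fun u => by ring
  rw [h1, h2, hs.tsum_sub hsK, hsK.tsum_sub hs']
  ring

/-- [folklore] `C·e^{−m s} ≤ C` for `C, m, s ≥ 0` (a far-decaying constant is dominated by its amplitude). -/
theorem mul_exp_neg_le {C m s : ℝ} (hC : 0 ≤ C) (hm : 0 ≤ m) (hs : 0 ≤ s) : C * Real.exp (-m * s) ≤ C := by
  have h : Real.exp (-m * s) ≤ 1 := Real.exp_le_one_iff.mpr (by nlinarith)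
  calc C * Real.exp (-m * s) ≤ C * 1 := mul_le_mul_of_nonneg_left h hC
    _ = C := mul_one C

/-- [folklore] A bi-localised kernel (rate `≥ 0`) is entrywise bounded by any constant dominating its amplitude. -/
theorem abs_le_of_biLoc {K : MKer D F} {p q : Fin D → ℤ} {C δ B : ℝ} (h : BiLoc K p q C δ) (hδ : 0 ≤ δ) (hCB : C ≤ B)
    (x z : Fin D → ℤ) (a b : F) : |K x z a b| ≤ B :=
  ((bdd_of_biLoc h hδ) x z a b).trans hCB

variable {N : ℕ}

/-- [folklore] Extension by zero is additive: `onLat N (g − g′) = onLat N g − onLat N g′`. -/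
theorem onLat_sub {α : Type*} [AddGroup α] (g g' : (Fin (d + 1) → ℤ) → α) : onLat N (g - g') = onLat N g - onLat N g' := by
  funext v
  by_cases hv : Torus.proj N v = 0
  · simp only [onLat, hv, if_true, Pi.sub_apply]
  · simp only [Pi.sub_apply, onLat_off _ hv, sub_zero]

/-- [folklore] **TELESCOPING OF COARSE-INDEXED SUPERPOSITIONS**: `cwsum N w Q − cwsum N w′ Q′ = cwsum N (w − w′) Q + cwsum N w′ (Q − Q′)` for
coarse weights decaying (fine units) from a point and kernel entries uniformly bounded in the coarse index. -/
theorem cwsum_sub_cwsum_bdd [NeZero N] {w w' : (Fin (d + 1) → ℤ) → ℝ} {Q Q' : (Fin (d + 1) → ℤ) → MKer (d + 1) (Fib d)}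
    {C C' m B B' : ℝ} {q : Fin (d + 1) → ℤ}
    (hw : ∀ y, |w y| ≤ C * Real.exp (-m * l1 ((N : ℤ) • y - q))) (hw' : ∀ y, |w' y| ≤ C' * Real.exp (-m * l1 ((N : ℤ) • y - q)))
    (hm : 0 < m) (hC : 0 ≤ C) (hC' : 0 ≤ C') (hQ : ∀ y x z a b, |Q y x z a b| ≤ B) (hQ' : ∀ y x z a b, |Q' y x z a b| ≤ B')
    (hB : 0 ≤ B) (hB' : 0 ≤ B') :
    cwsum N w Q - cwsum N w' Q' = cwsum N (w - w') Q + cwsum N w' (Q - Q') := by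
  unfold cwsum
  rw [onLat_sub, onLat_sub]
  refine wsum_sub_wsum_bdd (C := C) (C' := C') (B := B) (B' := B') (p := q) (fun v => ?_) (fun v => ?_) hm
    (fun v x z a b => ?_) (fun v x z a b => ?_)
  · by_cases hv : Torus.proj N v = 0
    · have e := eq_zsmul_quo_of_proj (N := N) hv
      simp only [onLat, hv, if_true]
      have h := hw (quo N v)
      rwa [← e] at h
    · rw [onLat_off w hv, abs_zero]
      positivity
  · by_cases hv : Torus.proj N v = 0
    · have e := eq_zsmul_quo_of_proj (N := N) hv
      simp only [onLat, hv, if_true]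
      have h := hw' (quo N v)
      rwa [← e] at h
    · rw [onLat_off w' hv, abs_zero]
      positivity
  · by_cases hv : Torus.proj N v = 0
    · simp only [onLat, hv, if_true]
      exact hQ _ _ _ _ _
    · rw [onLat_off Q hv]
      show |(0 : ℝ)| ≤ B
      rw [abs_zero]
      exact hB
  · by_cases hv : Torus.proj N v = 0
    · simp only [onLat, hv, if_true]
      exact hQ' _ _ _ _ _
    · rw [onLat_off Q' hv]
      show |(0 : ℝ)| ≤ B'
      rw [abs_zero]
      exact hB'

end Bricks

/-! ## §2 The multiplier-column vertex and `dM` are Lipschitz in `(K, S, M)` -/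

section LocFirst

variable {N : ℕ} [NeZero N]

omit [NeZero N] in
/-- [folklore] The multiplier column is linear in the kernel (entrywise). -/
theorem colM_sub (K K' : MKer (d + 1) (Fib d)) (N : ℕ) (μ : Fin (d + 1)) (y : Fin (d + 1) → ℤ) (ρ : Fin (d + 1))
    (w : Fin (d + 1) → ℤ) : colM (K - K') N μ y ρ w = colM K N μ y ρ w - colM K' N μ y ρ w := by
  simp [colM]

/-- [folklore] **THE MULTIPLIER-COLUMN VERTEX IS LIPSCHITZ IN `(K, M)`**: for decaying `K, K′` (constant `C`, deviation `εK`, rate `δK`) and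
coarse-localised multiplier tables `M, M′` (constant `CM`, deviation `εM`, rate `δ ≤ δK`):
`VertexFamily (vertexOfM K N M − vertexOfM K′ N M′) N ((d+1)·((εK·CM + C·εM)·Zl(δ/2))) (δ/2)` — the companion of asym1's
`HessKerRate.vertexFamily_vertexOfK_sub` (coarse superposition `cwsum` in place of `wsum`). -/
theorem vertexFamily_vertexOfM_sub {K K' : MKer (d + 1) (Fib d)} {C εK δK : ℝ} (hK : Decays K C δK) (hK' : Decays K' C δK)
    (hKK : Decays (K - K') εK δK)
    {M M' : Fin (d + 1) → (Fin (d + 1) → ℤ) → MKer (d + 1) (Fib d)} {CM εM δ : ℝ} (hM : VertexFamily M N CM δ)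
    (hM' : VertexFamily M' N CM δ) (hMM : VertexFamily (M - M') N εM δ) (hδ : 0 < δ) (hδK : δ ≤ δK) :
    VertexFamily (vertexOfM K N M - vertexOfM K' N M') N ((d + 1 : ℕ) * ((εK * CM + C * εM) * Zl (d + 1) (δ / 2))) (δ / 2) := by
  intro μ y
  have hC : 0 ≤ C := hK.nonneg (Sum.inl 0)
  have hεK : 0 ≤ εK := hKK.nonneg (Sum.inl 0)
  have hCM : 0 ≤ CM := (hM 0 0).nonneg (Sum.inl 0)
  have hw : ∀ ρ w, |colM K N μ y ρ w| ≤ C * Real.exp (-δ * l1 ((N : ℤ) • w - (N : ℤ) • y)) := fun ρ w =>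
    bound_mono (abs_colM_le (N := N) hK μ y ρ w) hC le_rfl hδK (l1_nonneg _)
  have hw' : ∀ ρ w, |colM K' N μ y ρ w| ≤ C * Real.exp (-δ * l1 ((N : ℤ) • w - (N : ℤ) • y)) := fun ρ w =>
    bound_mono (abs_colM_le (N := N) hK' μ y ρ w) hC le_rfl hδK (l1_nonneg _)
  have hww : ∀ ρ w, |(colM K N μ y ρ - colM K' N μ y ρ) w| ≤ εK * Real.exp (-δ * l1 ((N : ℤ) • w - (N : ℤ) • y)) :=
    fun ρ w => by
      rw [Pi.sub_apply, ← colM_sub]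
      exact bound_mono (abs_colM_le (N := N) hKK μ y ρ w) hεK le_rfl hδK (l1_nonneg _)
  have hMb : ∀ ρ w x z a b, |M ρ w x z a b| ≤ CM := fun ρ w x z a b => bdd_of_biLoc (hM ρ w) hδ.le x z a b
  have hMb' : ∀ ρ w x z a b, |M' ρ w x z a b| ≤ CM := fun ρ w x z a b => bdd_of_biLoc (hM' ρ w) hδ.le x z a b
  have hterm : ∀ ρ : Fin (d + 1), BiLoc (cwsum N (colM K N μ y ρ) (M ρ) - cwsum N (colM K' N μ y ρ) (M' ρ))
      ((N : ℤ) • y) ((N : ℤ) • y) ((εK * CM + C * εM) * Zl (d + 1) (δ / 2)) (δ / 2) := by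
    intro ρ
    rw [cwsum_sub_cwsum_bdd (hw ρ) (hw' ρ) hδ hC hC (hMb ρ) (hMb' ρ) hCM hCM]
    have h1 : BiLoc (cwsum N (colM K N μ y ρ - colM K' N μ y ρ) (M ρ)) ((N : ℤ) • y) ((N : ℤ) • y)
        (εK * CM * Zl (d + 1) (δ / 2)) (δ / 2) := biLoc_cwsum (hww ρ) (fun w => hM ρ w) hδ hεK
    have h2 : BiLoc (cwsum N (colM K' N μ y ρ) (M ρ - M' ρ)) ((N : ℤ) • y) ((N : ℤ) • y)
        (C * εM * Zl (d + 1) (δ / 2)) (δ / 2) := biLoc_cwsum (hw' ρ) (fun w => hMM ρ w) hδ hC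
    have h := biLoc_add h1 h2
    intro x z a b
    refine (h x z a b).trans (le_of_eq ?_)
    ring
  have hsum := OneStepResolventKernel.biLoc_finset_sum (Finset.univ : Finset (Fin (d + 1))) (fun ρ _ => hterm ρ)
  simp only [Finset.sum_const, Finset.card_univ, Fintype.card_fin, nsmul_eq_mul] at hsum
  intro x z a b
  have h := hsum x z a b
  simpa only [vertexOfM, Pi.sub_apply, Finset.sum_sub_distrib] using h

/-- [folklore] The Lipschitz constant of `dM` (rate `δ` in, `δ/2` out): the field-column part (asym1's `vertexFamily_vertexOfK_sub`) plus the
multiplier-column part (`vertexFamily_vertexOfM_sub`); LINEAR in `(εK, εS, εM)`. -/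
def ldM (d : ℕ) (C Cs CM εK εS εM δ : ℝ) : ℝ :=
  (d + 1 : ℕ) * ((εK * Cs + C * εS) * Zl (d + 1) (δ / 2)) + (d + 1 : ℕ) * ((εK * CM + C * εM) * Zl (d + 1) (δ / 2))

/-- [folklore] `ldM` is nonnegative for nonnegative inputs. -/
theorem ldM_nonneg {C Cs CM εK εS εM δ : ℝ} (hC : 0 ≤ C) (hCs : 0 ≤ Cs) (hCM : 0 ≤ CM) (hεK : 0 ≤ εK) (hεS : 0 ≤ εS)
    (hεM : 0 ≤ εM) (hδ : 0 < δ) : 0 ≤ ldM d C Cs CM εK εS εM δ := by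
  unfold ldM
  have := Zl_nonneg (D := d + 1) (half_pos hδ)
  positivity

/-- [folklore] **`dM` IS LIPSCHITZ IN `(K, S, M)`**: `VertexFamily (dM K N S M − dM K′ N S′ M′) N (ldM d C Cs CM εK εS εM δ) (δ/2)`. -/
theorem vertexFamily_dM_sub {K K' : MKer (d + 1) (Fib d)} {C εK δK : ℝ} (hK : Decays K C δK) (hK' : Decays K' C δK)
    (hKK : Decays (K - K') εK δK)
    {S S' : Fin (d + 1) → (Fin (d + 1) → ℤ) → MKer (d + 1) (Fib d)} {Cs εS : ℝ}
    {M M' : Fin (d + 1) → (Fin (d + 1) → ℤ) → MKer (d + 1) (Fib d)} {CM εM δ : ℝ}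
    (hS : LocStencil S Cs δ) (hS' : LocStencil S' Cs δ) (hSS : LocStencil (S - S') εS δ)
    (hM : VertexFamily M N CM δ) (hM' : VertexFamily M' N CM δ) (hMM : VertexFamily (M - M') N εM δ) (hδ : 0 < δ) (hδK : δ ≤ δK) :
    VertexFamily (dM K N S M - dM K' N S' M') N (ldM d C Cs CM εK εS εM δ) (δ / 2) := by
  intro μ y
  have h1 := vertexFamily_vertexOfK_sub hK hK' hKK hS hS' hSS hδ hδK N μ y
  have h2 := vertexFamily_vertexOfM_sub hK hK' hKK hM hM' hMM hδ hδK μ y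
  have h := biLoc_add h1 h2
  have e : (dM K N S M - dM K' N S' M') μ y
      = (vertexOfK K N S - vertexOfK K' N S') μ y + (vertexOfM K N M - vertexOfM K' N M') μ y := by
    funext x z a b
    simp only [dM, Pi.sub_apply, Pi.add_apply]
    ring
  rw [e]
  exact h

end LocFirst

/-! ## §3 The three-kernel sandwich and the derivative of the inverse are Lipschitz -/

section Sandwich

variable {N : ℕ} [NeZero N]

/-- [folklore] The Lipschitz constant of the sandwich `K∘V∘K` (rates: `K, V` at `m`; output `m/4`): asym1's `biLoc_comp_sub_comp` constant for
`K∘V − K′∘V′` carried through `biLoc_comp_right`, plus `K′∘V′` against the deviation of the right factor; LINEAR in `(εK, εV)`. -/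
def lSand (d : ℕ) (C CV εK εV m : ℝ) : ℝ :=
  (Fintype.card (Fib d) : ℝ) *
      (((Fintype.card (Fib d) : ℝ) * (εK * CV) * Zl (d + 1) (m / 2) + (Fintype.card (Fib d) : ℝ) * (C * εV) * Zl (d + 1) (m / 2)) * C) *
      Zl (d + 1) (m / 4) +
    (Fintype.card (Fib d) : ℝ) * (((Fintype.card (Fib d) : ℝ) * (C * CV) * Zl (d + 1) (m / 2)) * εK) * Zl (d + 1) (m / 4)

/-- [folklore] `lSand` is nonnegative for nonnegative inputs. -/
theorem lSand_nonneg {C CV εK εV m : ℝ} (hC : 0 ≤ C) (hCV : 0 ≤ CV) (hεK : 0 ≤ εK) (hεV : 0 ≤ εV) (hm : 0 < m) :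
    0 ≤ lSand d C CV εK εV m := by
  unfold lSand
  have h2 := Zl_nonneg (D := d + 1) (half_pos hm)
  have h4 := Zl_nonneg (D := d + 1) (show 0 < m / 4 by positivity)
  positivity

omit [NeZero N] in
/-- [folklore] **THE THREE-KERNEL SANDWICH IS LIPSCHITZ**: for `K, K′` decaying at rate `m` (constant `C`, deviation `Decays (K − K′) εK m`) and
`V, V′` bi-localised at `(p, q)` at rate `m` (constant `CV`, deviation `BiLoc (V − V′) p q εV m`), the difference `K∘V∘K − K′∘V′∘K′` is bi-localised at
`(p, q)` with constant `lSand d C CV εK εV m`, rate `m/4`.  Telescoping `X∘K − X′∘K′ = (X − X′)∘K + X′∘(K − K′)` (`X = K∘V`; `KernelWard.comp_sub_left∕right`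
under `slices_biLoc_bdd`), asym1's `HessKerRate.biLoc_comp_sub_comp` for `X − X′`, `BalabanStepJetsSucc.biLoc_comp_right` twice. -/
theorem biLoc_sandwich_sub {K K' V V' : MKer (d + 1) (Fib d)} {C εK CV εV m : ℝ} {p q : Fin (d + 1) → ℤ}
    (hK : Decays K C m) (hK' : Decays K' C m) (hKK : Decays (K - K') εK m) (hm : 0 < m)
    (hV : BiLoc V p q CV m) (hV' : BiLoc V' p q CV m) (hVV : BiLoc (V - V') p q εV m) :
    BiLoc (comp (comp K V) K - comp (comp K' V') K') p q (lSand d C CV εK εV m) (m / 4) := by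
  have hC : 0 ≤ C := hK.nonneg (Sum.inl 0)
  have hεK : 0 ≤ εK := hKK.nonneg (Sum.inl 0)
  have hm2 : 0 < m / 2 := half_pos hm
  have hX : BiLoc (comp K V) p q ((Fintype.card (Fib d) : ℝ) * (C * CV) * Zl (d + 1) (m / 2)) (m / 2) := by
    have h := biLoc_comp_decays hK hV hm2.le (by linarith)
    rwa [show m - m / 2 = m / 2 by ring] at h
  have hX' : BiLoc (comp K' V') p q ((Fintype.card (Fib d) : ℝ) * (C * CV) * Zl (d + 1) (m / 2)) (m / 2) := by
    have h := biLoc_comp_decays hK' hV' hm2.le (by linarith)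
    rwa [show m - m / 2 = m / 2 by ring] at h
  have hXX : BiLoc (comp K V - comp K' V') p q
      ((Fintype.card (Fib d) : ℝ) * (εK * CV) * Zl (d + 1) (m / 2) + (Fintype.card (Fib d) : ℝ) * (C * εV) * Zl (d + 1) (m / 2))
      (m / 2) := by
    have h := biLoc_comp_sub_comp hK hK' hKK hV hV' hVV hm
    rwa [show m - m / 2 = m / 2 by ring] at h
  -- the telescoping identity for the right composition with `K`
  have hKb : Bdd K C := bdd_of_decays hK hm.le
  have hKb' : Bdd K' C := bdd_of_decays hK' hm.le
  have e : comp (comp K V) K - comp (comp K' V') K'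
      = comp (comp K V - comp K' V') K + comp (comp K' V') (K - K') := by
    rw [comp_sub_left (slices_biLoc_bdd hX hKb hm2) (slices_biLoc_bdd hX' hKb hm2),
      comp_sub_right (slices_biLoc_bdd hX' hKb hm2) (slices_biLoc_bdd hX' hKb' hm2)]
    exact (sub_add_sub_cancel _ _ _).symm
  rw [e]
  have hK2 : Decays K C (m / 2) := decays_mono hK hC le_rfl (by linarith)
  have hKK2 : Decays (K - K') εK (m / 2) := decays_mono hKK hεK le_rfl (by linarith)
  have h1 := biLoc_comp_right hXX hK2 (show (0 : ℝ) ≤ m / 4 by positivity) (by linarith)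
  have h2 := biLoc_comp_right hX' hKK2 (show (0 : ℝ) ≤ m / 4 by positivity) (by linarith)
  rw [show m / 2 - m / 4 = m / 4 by ring] at h1 h2
  have h := biLoc_add h1 h2
  intro x z a b
  refine (h x z a b).trans (le_of_eq ?_)
  unfold lSand
  ring

/-- [folklore] The Lipschitz constant of the derivative of the inverse (rate `m` in, `m/8` out): the sandwich constant at rate `m/2` over the `dM`
data (`cdM` for the tables, `ldM` for their deviation); LINEAR in `(εK, εS, εM)`. -/
def lK2 (d : ℕ) (C Cs CM εK εS εM m : ℝ) : ℝ :=
  lSand d C (cdM d C Cs CM m) εK (ldM d C Cs CM εK εS εM m) (m / 2)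

/-- [folklore] `lK2` is nonnegative for nonnegative inputs. -/
theorem lK2_nonneg {C Cs CM εK εS εM m : ℝ} (hC : 0 ≤ C) (hCs : 0 ≤ Cs) (hCM : 0 ≤ CM) (hεK : 0 ≤ εK) (hεS : 0 ≤ εS)
    (hεM : 0 ≤ εM) (hm : 0 < m) : 0 ≤ lK2 d C Cs CM εK εS εM m :=
  lSand_nonneg hC (cdM_nonneg hC hCs hCM hm) hεK (ldM_nonneg hC hCs hCM hεK hεS hεM hm) (half_pos hm)

/-- [folklore] **THE DERIVATIVE OF THE INVERSE IS LIPSCHITZ IN `(K, S, M)`**: for packed kernels `K, K′` decaying at rate `m` (constant `C`,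
deviation `εK`) and first tables `S, S′` (`LocStencil`, constant `Cs`, deviation `εS`), `M, M′` (`VertexFamily`, constant `CM`, deviation `εM`) at
rate `m`: `VertexFamily (K2OfK K N S M − K2OfK K′ N S′ M′) N (lK2 d C Cs CM εK εS εM m) (m/8)` — same rate as an2's `vertexFamily_K2OfK`. -/
theorem vertexFamily_K2OfK_sub {K K' : MKer (d + 1) (Fib d)} {C εK m : ℝ} (hK : Decays K C m) (hK' : Decays K' C m)
    (hKK : Decays (K - K') εK m) (hm : 0 < m)
    {S S' : Fin (d + 1) → (Fin (d + 1) → ℤ) → MKer (d + 1) (Fib d)} {Cs εS : ℝ}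
    {M M' : Fin (d + 1) → (Fin (d + 1) → ℤ) → MKer (d + 1) (Fib d)} {CM εM : ℝ}
    (hS : LocStencil S Cs m) (hS' : LocStencil S' Cs m) (hSS : LocStencil (S - S') εS m)
    (hM : VertexFamily M N CM m) (hM' : VertexFamily M' N CM m) (hMM : VertexFamily (M - M') N εM m) :
    VertexFamily (K2OfK K N S M - K2OfK K' N S' M') N (lK2 d C Cs CM εK εS εM m) (m / 8) := by
  intro ν y'
  have hC : 0 ≤ C := hK.nonneg (Sum.inl 0)
  have hεK : 0 ≤ εK := hKK.nonneg (Sum.inl 0)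
  have hV : BiLoc (dM K N S M ν y') ((N : ℤ) • y') ((N : ℤ) • y') (cdM d C Cs CM m) (m / 2) :=
    vertexFamily_dM hK hC hS hM hm le_rfl ν y'
  have hV' : BiLoc (dM K' N S' M' ν y') ((N : ℤ) • y') ((N : ℤ) • y') (cdM d C Cs CM m) (m / 2) :=
    vertexFamily_dM hK' hC hS' hM' hm le_rfl ν y'
  have hVV : BiLoc (dM K N S M ν y' - dM K' N S' M' ν y') ((N : ℤ) • y') ((N : ℤ) • y')
      (ldM d C Cs CM εK εS εM m) (m / 2) :=
    vertexFamily_dM_sub hK hK' hKK hS hS' hSS hM hM' hMM hm le_rfl ν y'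
  have hK2 : Decays K C (m / 2) := decays_mono hK hC le_rfl (by linarith)
  have hK'2 : Decays K' C (m / 2) := decays_mono hK' hC le_rfl (by linarith)
  have hKK2 : Decays (K - K') εK (m / 2) := decays_mono hKK hεK le_rfl (by linarith)
  have h := biLoc_neg (biLoc_sandwich_sub hK2 hK'2 hKK2 (half_pos hm) hV hV' hVV)
  rw [show m / 2 / 4 = m / 8 by ring] at h
  intro x z a b
  have hx := h x z a b
  have e : (K2OfK K N S M - K2OfK K' N S' M') ν y' x z a b
      = -((comp (comp K (dM K N S M ν y')) K - comp (comp K' (dM K' N S' M' ν y')) K') x z a b) := by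
    simp only [K2OfK, Pi.sub_apply]
    ring
  rw [e]
  exact hx

end Sandwich

end Summit.QuantumFields.BalabanUV.Beta.GAN24.SecondOrderLipschitz

end
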